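import Summits.Ventures.DiscreteObjects.Hadamard.Order668Excluded
import Summits.Ventures.DiscreteObjects.Hadamard.Order167Centralizer668
import Summits.Ventures.DiscreteObjects.Hadamard.ElemAbelianRank2Large668
import Summits.Ventures.DiscreteObjects.Hadamard.InvolutionTypeII

/-!
# H(668): the centraliser of an element of order 167 acts FREELY on rows and columns; its elements have pair order
# `1, 2, 167` or `334`, square into `⟨σ⟩`, and fall into at most four classes modulo `⟨σ⟩` (kernel)

Framing: lottery ticket; floor = certified bounds/negative ranges.

Cell pub-namedobj (venture DiscreteObjects), target (H), hadamard gen 21.  Let `H` be a Hadamard matrix of order `668` and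
`σ = (π, κ, d, e)` a signed automorphism with `π^167 = κ^167 = 1`, `(π, κ) ≠ (1,1)` (gen 9: no fixed row or column, `4 + 4`
regular orbits).  Let `τ = (π', κ', d', e')` be a signed automorphism CENTRALISING `σ` at the pair level
(`π'π = ππ'`, `κ'κ = κκ'`).  Kernel consequences of the census already in the tree:
* **`centralizer167_orderOf_dvd`**: `orderOf (π', κ') ∣ 334`, i.e. the pair order is `1, 2, 167` or `334`
  [`τσ` has pair order divisible by `167`, hence equal to `167` or `334` (`OrderDvd167` + `Order668Excluded`); if
  `167 ∤ orderOf τ` the orders multiply].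
* **`centralizer167_involution_fpf`**: if `(π', κ')` has order `2` then `π'` fixes NO row and `κ'` NO column [the fixed rows
  form a `π`-stable set, a union of `167`-orbits; the involution census (gen 13, `hadamard668_involution_census_final`)
  allows only `f ≡ 4 (mod 8)`, `f ≤ 332`, or `f = 0`].
* **`hadamard668_order167_centralizer_free`**: if `(π', κ') ≠ (1,1)` then `π'` fixes no row and `κ'` fixes no column —
  **the centraliser acts freely (semiregularly) on the `668` rows and on the `668` columns** [order `167`: gen 9; order
  `334`: its `167`-th power is a centralising involution].
* **`hadamard668_order167_centralizer_sq_mem`**: `(π'², κ'²) = (π^c, κ^c)` for some `c` [pair order `∣ 334` makes `τ²` of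
  exponent `167`; no `C₁₆₇ × C₁₆₇` (gen 16, `no_hadamard668_elemAbelian_rank2_large`) via the dictionary lemma
  `rowIndep_of_not_pow`].  So `C(σ)/⟨σ⟩` has exponent `2` at the pair level (hence is elementary abelian).
* **`hadamard668_order167_centralizer_eq_of_sameOrbit`**, **`hadamard668_order167_centralizer_index_le_four`**: a centralising
  `τ` is determined modulo `⟨σ⟩` by the `σ`-orbit containing `π' x₀` (`x₀` any row); among any five centralising signed
  automorphisms two are congruent modulo `⟨σ⟩` — **`|C(σ) : ±⟨σ⟩| ≤ 4`** (the Williamson array with its quaternion block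
  symmetries attains `4`).
With gen 19 (`hadamard668_order167_centralizer_rowOrbits`: orbit-preserving centraliser `= ⟨σ⟩`) and gen 20 (`N/C ≤ C₂`):
the pair group generated by the centraliser of `σ` has order `167`, `334` or `668` and, in the last case, acts REGULARLY on rows
and columns (H is then developed over a group of order `668` modulo signs).  STRUCTURE of a hypothetical object; no automorphism
order and no Hadamard order is excluded; H(668) untouched; HITS 0/4.  Ours; no `sorry`, no definitions, default heartbeats.
-/

namespace Summit.Ventures.DiscreteObjects.Hadamard

open Finset BigOperators Matrix

open Literature.Combinatorics.Designs.GoethalsSeidel (IsHadamardMatrix)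

variable {ι : Type*} [Fintype ι] [DecidableEq ι]

/-! ### permutation lemma: the fixed set of a commuting permutation is a union of orbits -/

/-- if `ψ` commutes with a fixed-point-free permutation `π` of prime exponent `p`, then `p` divides the number of fixed points
of `ψ` (the fixed set is `π`-stable, and `π` acts on it without fixed points) -/
lemma dvd_card_fixed_of_commute {π ψ : Equiv.Perm ι} (hc : Commute ψ π) {p : ℕ} (hp : p.Prime) (hπ : π ^ p = 1)
    (hπfix : ∀ x, π x ≠ x) : p ∣ (univ.filter fun x => ψ x = x).card := by
  have hstab : ∀ x, ψ x = x ↔ ψ (π x) = π x := by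
    intro x
    have h1 : ψ (π x) = π (ψ x) := by
      rw [← Equiv.Perm.mul_apply, hc.eq, Equiv.Perm.mul_apply]
    constructor
    · intro h; rw [h1, h]
    · intro h; rw [h1] at h; exact π.injective h
  set ρ : Equiv.Perm {x // ψ x = x} := π.subtypePerm (fun x => (hstab x).symm) with hρ
  have hρp : ρ ^ p = 1 := by
    rw [hρ, Equiv.Perm.subtypePerm_pow]
    ext ⟨x, hx⟩
    change (π ^ p) x = x
    rw [hπ, Equiv.Perm.one_apply]
  have hρfix : (univ.filter fun y : {x // ψ x = x} => ρ y = y).card = 0 := by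
    rw [Finset.card_eq_zero, Finset.filter_eq_empty_iff]
    rintro ⟨x, hx⟩ - h
    apply hπfix x
    have h' := congrArg Subtype.val h
    simpa [hρ] using h'
  have hcl := card_fixed_add_classes ρ hp hρp
  rw [hρfix, zero_add, Fintype.card_subtype] at hcl
  exact ⟨_, by rw [← hcl, mul_comm]⟩

/-! ### dictionary lemma: a commuting element of exponent `p` that is not a power of `σ` is independent of it -/

section dictionary
variable {H : Matrix ι ι ℤ}

/-- **non-power ⇒ independent.**  `σ = (π, κ)` a signed automorphism with `π^p = κ^p = 1`, `(π, κ) ≠ (1,1)` (`p` an odd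
prime), `(α, α')` a signed automorphism with `α^p = α'^p = 1` and `α'` commuting with `κ`.  If `(α, α')` is not a power
`(π^c, κ^c)` then the row parts `π`, `α` are independent: `π^a α^b = 1` with `a, b < p` forces `a = b = 0`.  [If `b ≠ 0`,
invert `b` mod `p`: `α = π^c`; then `(α, α') (π, κ)^{-c}` has trivial row part and odd exponent, so trivial column part
(`signedAut_snd_eq_one`).  If `b = 0 ≠ a` then `π = 1`, and again `κ = 1`.] -/
lemma rowIndep_of_not_pow (hH : IsHadamardMatrix H) (hcard : (Fintype.card ι : ℤ) ≠ 0) {p : ℕ} (hp : p.Prime)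
    (hodd : Odd p) {π κ α α' : Equiv.Perm ι} {d e d₁ e₁ : ι → ℤ} (haut : IsSignedAut H π κ d e)
    (hA : IsSignedAut H α α' d₁ e₁) (hπ : π ^ p = 1) (hκ : κ ^ p = 1) (hne : π ≠ 1 ∨ κ ≠ 1) (hα : α ^ p = 1)
    (hα' : α' ^ p = 1) (hc' : Commute α' κ) (hnot : ∀ c : ℕ, α = π ^ c → α' ≠ κ ^ c) :
    ∀ a b : ℕ, a < p → b < p → π ^ a * α ^ b = 1 → a = 0 ∧ b = 0 := by
  intro a b ha hb hab
  by_cases hb0 : b = 0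
  · subst hb0
    rw [pow_zero, mul_one] at hab
    by_cases ha0 : a = 0
    · exact ⟨ha0, rfl⟩
    · exfalso
      -- π^a = 1 with 0 < a < p forces π = 1, then κ = 1
      have hg : π ^ Nat.gcd a p = 1 := pow_gcd_eq_one.mpr ⟨hab, hπ⟩
      have hcop : Nat.gcd a p = 1 := (Nat.coprime_of_lt_prime ha0 ha hp).symm.gcd_eq_one
      rw [hcop, pow_one] at hg
      rcases hne with h | h
      · exact h hg
      · rw [hg] at haut
        exact h (signedAut_snd_eq_one H hH hcard haut hodd hκ)
  · exfalso
    -- invert b modulo p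
    obtain ⟨m, -, hm⟩ := Nat.exists_mul_mod_eq_one_of_coprime (Nat.coprime_of_lt_prime hb0 hb hp).symm hp.one_lt
    have hbm : b * m = p * (b * m / p) + 1 := by
      have := Nat.div_add_mod (b * m) p; omega
    -- α^b = π^(p - a)
    have hαb : α ^ b = π ^ (p - a) := by
      have h1 : π ^ (p - a) * π ^ a = 1 := by rw [← pow_add, Nat.sub_add_cancel ha.le, hπ]
      calc α ^ b = (π ^ (p - a) * π ^ a) * α ^ b := by rw [h1, one_mul]
        _ = π ^ (p - a) * (π ^ a * α ^ b) := by rw [mul_assoc]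
        _ = π ^ (p - a) := by rw [hab, mul_one]
    set c : ℕ := (p - a) * m with hcdef
    have hαc : α = π ^ c := by
      calc α = α ^ (b * m) := by rw [hbm, pow_add, pow_one, pow_mul, hα, one_pow, one_mul]
        _ = π ^ c := by rw [pow_mul, hαb, ← pow_mul]
    -- the column part: (α, α') σ^(c') with c + c' ≡ 0 has trivial row part
    obtain ⟨c', q, hcq⟩ : ∃ c' q : ℕ, c + c' = p * q := ⟨p - c % p, c / p + 1, by
      have h1 := Nat.div_add_mod c p; have h2 := Nat.mod_lt c hp.pos; rw [Nat.mul_add, mul_one]; omega⟩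
    have hrow : α * π ^ c' = 1 := by rw [hαc, ← pow_add, hcq, pow_mul, hπ, one_pow]
    have hρ := isSignedAut_mul hA (isSignedAut_pow haut c')
    rw [hrow] at hρ
    have hcolp : (α' * κ ^ c') ^ p = 1 := by
      rw [(hc'.pow_right c').mul_pow, hα', one_mul, ← pow_mul, mul_comm, pow_mul, hκ, one_pow]
    have hcol : α' * κ ^ c' = 1 := signedAut_snd_eq_one H hH hcard hρ hodd hcolp
    apply hnot c hαc
    have hκc : κ ^ c' * κ ^ c = 1 := by rw [← pow_add, add_comm, hcq, pow_mul, hκ, one_pow]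
    calc α' = α' * (κ ^ c' * κ ^ c) := by rw [hκc, mul_one]
      _ = (α' * κ ^ c') * κ ^ c := by rw [mul_assoc]
      _ = κ ^ c := by rw [hcol, one_mul]

end dictionary

/-! ### the centraliser of an element of order 167 -/

section centralizer
variable {H : Matrix ι ι ℤ} (hH : IsHadamardMatrix H) (hι : Fintype.card ι = 668)
  {π κ π' κ' : Equiv.Perm ι} {d e d' e' : ι → ℤ} (haut : IsSignedAut H π κ d e)
  (hπ : π ^ 167 = 1) (hκ : κ ^ 167 = 1) (hne : π ≠ 1 ∨ κ ≠ 1) (haut' : IsSignedAut H π' κ' d' e')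
  (hcπ : Commute π' π) (hcκ : Commute κ' κ)
include hH hι haut hπ hκ hne haut' hcπ hcκ

/-- **pair orders in the centraliser of an element of order 167 divide `334`** (so they are `1, 2, 167, 334`). -/
theorem centralizer167_orderOf_dvd : orderOf ((π', κ') : Equiv.Perm ι × Equiv.Perm ι) ∣ 334 := by
  haveI : Fact (Nat.Prime 167) := ⟨by norm_num⟩
  have p167 : Nat.Prime 167 := by norm_num
  have hS : orderOf ((π, κ) : Equiv.Perm ι × Equiv.Perm ι) = 167 := by
    refine orderOf_eq_prime ?_ ?_
    · rw [Prod.pow_mk, hπ, hκ]; rfl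
    · intro h
      rw [Prod.mk_eq_one] at h
      rcases hne with h' | h'
      · exact h' h.1
      · exact h' h.2
  have hcomm : Commute ((π', κ') : Equiv.Perm ι × Equiv.Perm ι) (π, κ) := by
    show (π', κ') * (π, κ) = (π, κ) * (π', κ')
    rw [Prod.mk_mul_mk, Prod.mk_mul_mk, hcπ.eq, hcκ.eq]
  by_cases h167 : 167 ∣ orderOf ((π', κ') : Equiv.Perm ι × Equiv.Perm ι)
  · rcases hadamard668_signedAut_orderOf_of_167_dvd' hH hι π' κ' d' e' haut' h167 with h | h
    · rw [h]; norm_num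
    · rw [h]
  · have hcop : (orderOf ((π', κ') : Equiv.Perm ι × Equiv.Perm ι)).Coprime
        (orderOf ((π, κ) : Equiv.Perm ι × Equiv.Perm ι)) := by
      rw [hS]; exact ((Nat.Prime.coprime_iff_not_dvd p167).mpr h167).symm
    have hmul := hcomm.orderOf_mul_eq_mul_orderOf_of_coprime hcop
    rw [hS, Prod.mk_mul_mk] at hmul
    have h167' : 167 ∣ orderOf ((π' * π, κ' * κ) : Equiv.Perm ι × Equiv.Perm ι) := by
      rw [hmul]; exact dvd_mul_left _ _
    rcases hadamard668_signedAut_orderOf_of_167_dvd' hH hι (π' * π) (κ' * κ) _ _ (isSignedAut_mul haut' haut) h167'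
      with h | h
    · rw [hmul] at h
      have h1 : orderOf ((π', κ') : Equiv.Perm ι × Equiv.Perm ι) = 1 := by omega
      rw [h1]; norm_num
    · rw [hmul] at h
      have h2 : orderOf ((π', κ') : Equiv.Perm ι × Equiv.Perm ι) = 2 := by omega
      rw [h2]; norm_num

/-- pointwise form: `π'^334 = 1` and `κ'^334 = 1` -/
theorem centralizer167_pow_334 : π' ^ 334 = 1 ∧ κ' ^ 334 = 1 := by
  have h := orderOf_dvd_iff_pow_eq_one.mp (centralizer167_orderOf_dvd hH hι haut hπ hκ hne haut' hcπ hcκ)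
  rw [Prod.pow_mk, Prod.mk_eq_one] at h
  exact h

omit hcκ in
/-- **a centralising involution is fixed-point-free on rows and columns** (`π'² = κ'² = 1`, `(π', κ') ≠ (1,1)`;
only the row parts need to commute). -/
theorem centralizer167_involution_fpf (h2 : π' ^ 2 = 1) (h2' : κ' ^ 2 = 1) (hne' : π' ≠ 1 ∨ κ' ≠ 1) :
    (∀ x, π' x ≠ x) ∧ (∀ y, κ' y ≠ y) := by
  have p167 : Nat.Prime 167 := by norm_num
  have h167 := hadamard668_fixedRows_167 hH hι π κ d e haut hπ hκ hne
  have hπfix : ∀ x, π x ≠ x := moved_of_card_fixed_eq_zero π h167.1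
  have hdπ : 167 ∣ (univ.filter fun x => π' x = x).card := dvd_card_fixed_of_commute hcπ p167 hπ hπfix
  obtain ⟨-, -, hcases⟩ := hadamard668_involution_census_final hH hι π' κ' d' e' haut' h2 h2' hne'
  rcases hcases with ⟨-, hmod8, h4, h332, -⟩ | ⟨h0, h0', -, -⟩
  · exfalso
    obtain ⟨m, hm⟩ := hdπ
    rw [hm] at hmod8 h4 h332
    omega
  · exact ⟨moved_of_card_fixed_eq_zero π' h0, moved_of_card_fixed_eq_zero κ' h0'⟩

/-- **The centraliser of an element of order 167 acts freely on rows and on columns**: a non-trivial centralising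
signed automorphism fixes no row and no column. -/
theorem hadamard668_order167_centralizer_free (hne' : π' ≠ 1 ∨ κ' ≠ 1) :
    (∀ x, π' x ≠ x) ∧ (∀ y, κ' y ≠ y) := by
  have hdvd := centralizer167_orderOf_dvd hH hι haut hπ hκ hne haut' hcπ hcκ
  have hmem : orderOf ((π', κ') : Equiv.Perm ι × Equiv.Perm ι) ∈ Nat.divisors 334 :=
    Nat.mem_divisors.mpr ⟨hdvd, by norm_num⟩
  have hdiv : Nat.divisors 334 = {1, 2, 167, 334} := by decide
  rw [hdiv] at hmem
  simp only [Finset.mem_insert, Finset.mem_singleton] at hmem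
  rcases hmem with h | h | h | h
  · -- order 1: the pair is trivial
    exfalso
    have h1 : ((π', κ') : Equiv.Perm ι × Equiv.Perm ι) = 1 := orderOf_eq_one_iff.mp h
    rw [Prod.mk_eq_one] at h1
    rcases hne' with h' | h'
    · exact h' h1.1
    · exact h' h1.2
  · -- order 2: a centralising involution
    obtain ⟨hp1, hp2, hn⟩ := pow_data_of_orderOf h (a := 1) one_pos (by norm_num)
    rw [pow_one, pow_one] at hn
    exact centralizer167_involution_fpf hH hι haut hπ hκ hne haut' hcπ hp1 hp2 hn
  · -- order 167: gen 9
    obtain ⟨hp1, hp2, hn⟩ := pow_data_of_orderOf h (a := 1) one_pos (by norm_num)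
    rw [pow_one, pow_one] at hn
    have hf := hadamard668_fixedRows_167 hH hι π' κ' d' e' haut' hp1 hp2 hn
    exact ⟨moved_of_card_fixed_eq_zero π' hf.1, moved_of_card_fixed_eq_zero κ' hf.2.1⟩
  · -- order 334: the 167-th power is a centralising involution
    obtain ⟨hp1, hp2, hn⟩ := pow_data_of_orderOf h (a := 167) (by norm_num) (by norm_num)
    have h2 : (π' ^ 167) ^ 2 = 1 := by rw [← pow_mul]; exact hp1
    have h2' : (κ' ^ 167) ^ 2 = 1 := by rw [← pow_mul]; exact hp2
    obtain ⟨hr, hc⟩ := centralizer167_involution_fpf hH hι haut hπ hκ hne (isSignedAut_pow haut' 167)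
      (hcπ.pow_left 167) h2 h2' hn
    exact ⟨fun x hx => hr x (perm_pow_apply_of_fixed π' hx 167), fun y hy => hc y (perm_pow_apply_of_fixed κ' hy 167)⟩

/-- **Squares of centralising elements are powers of `σ`**: `(π'², κ'²) = (π^c, κ^c)` for some `c`. -/
theorem hadamard668_order167_centralizer_sq_mem : ∃ c : ℕ, π' ^ 2 = π ^ c ∧ κ' ^ 2 = κ ^ c := by
  have p167 : Nat.Prime 167 := by norm_num
  have hcard : (Fintype.card ι : ℤ) ≠ 0 := by rw [hι]; norm_num
  obtain ⟨h334, h334'⟩ := centralizer167_pow_334 hH hι haut hπ hκ hne haut' hcπ hcκ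
  have hα : (π' ^ 2) ^ 167 = 1 := by rw [← pow_mul]; exact h334
  have hα' : (κ' ^ 2) ^ 167 = 1 := by rw [← pow_mul]; exact h334'
  by_contra hnot
  push Not at hnot
  have hind := rowIndep_of_not_pow hH hcard p167 (by decide) haut (isSignedAut_pow haut' 2) hπ hκ hne hα hα'
    (hcκ.pow_left 2) hnot
  exact no_hadamard668_elemAbelian_rank2_large hH hι 167 p167 (by norm_num) (by norm_num) haut (isSignedAut_pow haut' 2)
    hπ hκ hα hα' (hcπ.pow_left 2).symm (hcκ.pow_left 2).symm hind

end centralizer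

/-! ### classes modulo `⟨σ⟩`: at most four -/

section index
variable {H : Matrix ι ι ℤ} (hH : IsHadamardMatrix H) (hι : Fintype.card ι = 668)
  {π κ : Equiv.Perm ι} {d e : ι → ℤ} (haut : IsSignedAut H π κ d e)
  (hπ : π ^ 167 = 1) (hκ : κ ^ 167 = 1) (hne : π ≠ 1 ∨ κ ≠ 1)
include hH hι haut hπ hκ hne

/-- **A centralising element is determined modulo `⟨σ⟩` by the `σ`-orbit of the image of one row.**  If `τ₁ = (π₁, κ₁)`,
`τ₂ = (π₂, κ₂)` centralise `σ` and `π₂ x₀` lies in the `π`-orbit of `π₁ x₀`, then `(π₂, κ₂) = (π₁ π^c, κ₁ κ^c)`. -/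
theorem hadamard668_order167_centralizer_eq_of_sameOrbit {π₁ κ₁ π₂ κ₂ : Equiv.Perm ι} {d₁ e₁ d₂ e₂ : ι → ℤ}
    (h₁ : IsSignedAut H π₁ κ₁ d₁ e₁) (h₂ : IsSignedAut H π₂ κ₂ d₂ e₂) (hc₁ : Commute π₁ π) (hc₁' : Commute κ₁ κ)
    (hc₂ : Commute π₂ π) (hc₂' : Commute κ₂ κ) {x₀ : ι} (hx : π₂ x₀ ∈ orbFin π 167 (π₁ x₀)) :
    ∃ c : ℕ, π₂ = π₁ * π ^ c ∧ κ₂ = κ₁ * κ ^ c := by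
  obtain ⟨c, -, hcx⟩ := Finset.mem_image.mp hx
  -- n = pair order of τ₁; ρ = τ₁^(n-1) τ₂ σ^(c') with c + c' ≡ 0 fixes x₀
  set n := orderOf ((π₁, κ₁) : Equiv.Perm ι × Equiv.Perm ι) with hn
  have hn0 : 0 < n := orderOf_pos _
  have hPn : π₁ ^ n = 1 ∧ κ₁ ^ n = 1 := by
    have h := pow_orderOf_eq_one ((π₁, κ₁) : Equiv.Perm ι × Equiv.Perm ι)
    rw [← hn, Prod.pow_mk, Prod.mk_eq_one] at h
    exact h
  obtain ⟨c', q, hcq⟩ : ∃ c' q : ℕ, c + c' = 167 * q := ⟨167 - c % 167, c / 167 + 1, by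
    have := Nat.div_add_mod c 167; have := Nat.mod_lt c (by norm_num : 0 < 167); omega⟩
  have hρ := isSignedAut_mul (isSignedAut_pow h₁ (n - 1)) (isSignedAut_mul h₂ (isSignedAut_pow haut c'))
  -- ρ commutes with σ
  have hcρ : Commute (π₁ ^ (n - 1) * (π₂ * π ^ c')) π :=
    (hc₁.pow_left (n - 1)).mul_left (hc₂.mul_left (Commute.pow_left (Commute.refl π) c'))
  have hcρ' : Commute (κ₁ ^ (n - 1) * (κ₂ * κ ^ c')) κ :=
    (hc₁'.pow_left (n - 1)).mul_left (hc₂'.mul_left (Commute.pow_left (Commute.refl κ) c'))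
  -- ρ fixes x₀
  have hfix : (π₁ ^ (n - 1) * (π₂ * π ^ c')) x₀ = x₀ := by
    have h1 : π₂ ((π ^ c') x₀) = π₁ x₀ := by
      rw [← Equiv.Perm.mul_apply, (hc₂.pow_right c').eq, Equiv.Perm.mul_apply, ← hcx, ← Equiv.Perm.mul_apply,
        ← pow_add, add_comm, hcq, pow_mul, hπ, one_pow, Equiv.Perm.one_apply]
    rw [Equiv.Perm.mul_apply, Equiv.Perm.mul_apply, h1, ← Equiv.Perm.mul_apply, ← pow_succ, Nat.sub_add_cancel hn0,
      hPn.1, Equiv.Perm.one_apply]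
  -- hence ρ is trivial
  have hρ1 : π₁ ^ (n - 1) * (π₂ * π ^ c') = 1 ∧ κ₁ ^ (n - 1) * (κ₂ * κ ^ c') = 1 := by
    by_contra hne'
    rw [not_and_or] at hne'
    exact (hadamard668_order167_centralizer_free hH hι haut hπ hκ hne hρ hcρ hcρ' hne').1 x₀ hfix
  refine ⟨c, ?_, ?_⟩
  · have hb : π ^ c' * π ^ c = 1 := by rw [← pow_add, add_comm, hcq, pow_mul, hπ, one_pow]
    have h3 : π₁ * (π₁ ^ (n - 1) * (π₂ * π ^ c')) = π₂ * π ^ c' := by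
      rw [← mul_assoc, ← pow_succ', Nat.sub_add_cancel hn0, hPn.1, one_mul]
    rw [hρ1.1, mul_one] at h3
    calc π₂ = π₂ * (π ^ c' * π ^ c) := by rw [hb, mul_one]
      _ = (π₂ * π ^ c') * π ^ c := by rw [mul_assoc]
      _ = π₁ * π ^ c := by rw [← h3]
  · have hb : κ ^ c' * κ ^ c = 1 := by rw [← pow_add, add_comm, hcq, pow_mul, hκ, one_pow]
    have h3 : κ₁ * (κ₁ ^ (n - 1) * (κ₂ * κ ^ c')) = κ₂ * κ ^ c' := by
      rw [← mul_assoc, ← pow_succ', Nat.sub_add_cancel hn0, hPn.2, one_mul]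
    rw [hρ1.2, mul_one] at h3
    calc κ₂ = κ₂ * (κ ^ c' * κ ^ c) := by rw [hb, mul_one]
      _ = (κ₂ * κ ^ c') * κ ^ c := by rw [mul_assoc]
      _ = κ₁ * κ ^ c := by rw [← h3]

/-- **At most four classes modulo `⟨σ⟩`**: among any five signed automorphisms centralising `σ`, two are congruent modulo
`⟨σ⟩` (`|C(σ) : ±⟨σ⟩| ≤ 4`). -/
theorem hadamard668_order167_centralizer_index_le_four (πs κs : Fin 5 → Equiv.Perm ι) (ds es : Fin 5 → ι → ℤ)
    (hs : ∀ i, IsSignedAut H (πs i) (κs i) (ds i) (es i)) (hcs : ∀ i, Commute (πs i) π) (hcs' : ∀ i, Commute (κs i) κ) :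
    ∃ i j : Fin 5, i ≠ j ∧ ∃ c : ℕ, πs j = πs i * π ^ c ∧ κs j = κs i * κ ^ c := by
  have h167 := hadamard668_fixedRows_167 hH hι π κ d e haut hπ hκ hne
  have hπfix : ∀ x, π x ≠ x := moved_of_card_fixed_eq_zero π h167.1
  obtain ⟨x₀⟩ : Nonempty ι := Fintype.card_pos_iff.mp (by rw [hι]; norm_num)
  -- pigeonhole: five orbits among the four classes of π
  have hmaps : ∀ i ∈ (univ : Finset (Fin 5)), orbFin π 167 ((πs i) x₀) ∈ blockClasses π 167 := by
    intro i _
    exact Finset.mem_image_of_mem _ (Finset.mem_filter.mpr ⟨Finset.mem_univ _, hπfix _⟩)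
  have hlt : (blockClasses π 167).card < (univ : Finset (Fin 5)).card := by
    rw [h167.2.2.1, Finset.card_univ, Fintype.card_fin]; norm_num
  obtain ⟨i, -, j, -, hij, hij'⟩ := Finset.exists_ne_map_eq_of_card_lt_of_maps_to hlt hmaps
  refine ⟨i, j, hij, ?_⟩
  have hx : (πs j) x₀ ∈ orbFin π 167 ((πs i) x₀) := by
    rw [hij']; exact mem_orbFin_self π (by norm_num) _
  exact hadamard668_order167_centralizer_eq_of_sameOrbit hH hι haut hπ hκ hne (hs i) (hs j) (hcs i) (hcs' i) (hcs j)
    (hcs' j) hx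

end index

end Summit.Ventures.DiscreteObjects.Hadamard
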